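/-
Copyright (c) 2026. All rights reserved.
Released under Apache 2.0 license as described in the file LICENSE.
Authors: abc-iut cell, seat abc-iut-f-069 (gen 3; F-0297 `Prop_1_3_i` at constructed data — the seat's own tranche row).
-/
import Literature.AnabelianGeometry.AbsoluteAnabelian.AbsTopII.DPSCIndexDataOfEmbedding
import Literature.AnabelianGeometry.AbsoluteAnabelian.FreeProcyclicModel

/-!
# [AbsTopII] Prop 1.3 (i) AS TYPED (F-0297) at the constructed DPSC data, from [CombGC] Rmk 1.1.3

S. Mochizuki, *Topics in Absolute Anabelian Geometry II* [AbsTopII] (bib `MochizukiAbsTopII2013`; kurims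
manuscript `paper:url-585b8d0ad0d9`), §1 Prop 1.3 (i) p. 11: "`Π_𝔾` is slim. Every edge-like subgroup of
`Π_H` is commensurably terminal and isomorphic to `Ẑ^Σ`, as an abstract profinite group. If `e` is a cusp
of `𝔾`, then as abstract profinite groups, `I_e ≅ Ẑ^Σ`" ("follows immediately from the definitions");
[CombGC] (bib `MochizukiCombGC2007`) Rmk 1.1.3 p. 7 (edge-like subgroups `≅ Ẑ^Σ`).

PROOF-ONLY (no definition).  The cell's F-0297 `DPSCIndexData.Prop_1_3_i` (abc-iut-L4-t6, p405221) has its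
universal closure refuted (abc-iut-f-069 p427867) and an L3 bridge at `Σ = {l}` (p428564).  Here, at the
constructed data `DPSCIndexData.ofEmbedding` / `ofOuterAction` (p440384), it is PROVED for every `Σ` from
the ONE printed input it rests on: the PSC datum's cuspidal subgroups are free pro-`Σ`-cyclic ([CombGC]
Rmk 1.1.3) — `I_e := Π_e = ι(Π_{𝒢,e})` and `ι` restricts to an isomorphism of topological groups
`Π_{𝒢,e} ≃ₜ* ι(Π_{𝒢,e})` (continuous injective homomorphism from a compact group, closed subgroup).
HONEST FRAMING: the input "cuspidal subgroups `≅ Ẑ^Σ`" stays a hypothesis on the PSC datum (typed ≠ proved;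
layer L3's [CombGC] Rmk 1.1.3); nothing here bears on [IUTchIII] Cor 3.12 or takes a side on any author.
-/

noncomputable section

open scoped Pointwise

namespace Literature.AnabelianGeometry.AbsoluteAnabelian

open Literature.AnabelianGeometry.SemiGraphs
open Literature.AnabelianGeometry.Anabelioids (IsSigmaInteger)
open Topology

universe u

namespace AbsTopII.DPSCIndexData

section Embedding

variable {P : Type u} [Group P] [TopologicalSpace P] [CompactSpace P]
  (G : PSCDatum P) (E : ProfiniteGrp.{u}) (ι : P →* E) (hιc : Continuous ι)
  (hιi : Function.Injective ι) (hιr : IsClosed (ι.range : Set E)) (hιn : ι.range.Normal)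
  (PiI : Subgroup E) (hIn : PiI.Normal) (hle : ι.range ≤ PiI)
  (σ : G.graph.N → ℕ) (hσ : ∀ e, IsSigmaInteger G.Sigma (σ e))

include hιc hιi

/-- The embedding restricts to an isomorphism of topological groups from a CLOSED subgroup `K ⊆ Π_𝒢` onto its
image `ι(K) ⊆ Π_H` (continuous bijective homomorphism from a compact group to a Hausdorff one).
[cite: MochizukiAbsTopII2013, Def 1.2 (ii) p.10] -/
theorem exists_subgroupEquiv_ofEmbedding {K : Subgroup P} (hK : IsClosed (K : Set P)) :
    ∃ e : ↥K ≃ₜ* ↥(K.map ι), ∀ x : ↥K, ((e x : ↥(K.map ι)) : E) = ι x := by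
  let f : ↥K →* ↥(K.map ι) := ι.subgroupMap K
  have hf : ∀ x : ↥K, ((f x : ↥(K.map ι)) : E) = ι x := fun _ => rfl
  have hinj : Function.Injective f := by
    intro x y hxy
    apply Subtype.ext
    apply hιi
    rw [← hf x, ← hf y, hxy]
  have hsurj : Function.Surjective f := ι.subgroupMap_surjective K
  have hfc : Continuous f := (hιc.comp continuous_subtype_val).subtype_mk _
  haveI : CompactSpace ↥K := isCompact_iff_compactSpace.mp hK.isCompact
  let fe : ↥K ≃ ↥(K.map ι) := Equiv.ofBijective f ⟨hinj, hsurj⟩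
  have hfec : Continuous fe := hfc
  let h : ↥K ≃ₜ ↥(K.map ι) := hfec.homeoOfEquivCompactToT2
  exact ⟨{ f with
      toFun := fe, invFun := fe.symm, left_inv := fe.left_inv, right_inv := fe.right_inv,
      continuous_toFun := hfec, continuous_invFun := h.continuous_symm }, fun x => rfl⟩

/-- **[AbsTopII] Prop 1.3 (i) AS TYPED (F-0297, `DPSCIndexData.Prop_1_3_i`: "if `e` is a cusp of `𝔾`, then as
abstract profinite groups `I_e ≅ Ẑ^Σ`") at every embedded datum**, from [CombGC] Rmk 1.1.3 for the PSC
datum — its cuspidal subgroups are free pro-`Σ`-cyclic: `I_e := Π_e = ι(Π_{𝒢,e}) ≃ₜ* Π_{𝒢,e}`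
(`IsFreeProSigmaCyclic.of_continuousMulEquiv`).  "Follows immediately from the definitions" (p. 11).
[cite: MochizukiAbsTopII2013, Prop 1.3 (i) p.11] [cite: MochizukiCombGC2007, Rmk 1.1.3 p.7] -/
theorem prop_1_3_i_ofEmbedding (hcyc : ∀ c : G.graph.C, IsFreeProSigmaCyclic G.Sigma ↥(G.cuspGp c)) :
    Literature.AnabelianGeometry.AbsoluteAnabelian.AbsTopII.DPSCIndexData.Prop_1_3_i
      (ofEmbedding G E ι hιr hιn PiI hIn hle σ hσ) := by
  intro c
  obtain ⟨e, -⟩ := exists_subgroupEquiv_ofEmbedding E ι hιc hιi (G.isClosed_cuspGp c.down)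
  exact (hcyc c.down).of_continuousMulEquiv e

end Embedding

section OuterAction

variable {P : Type u} [Group P] [TopologicalSpace P] [IsTopologicalGroup P] [CompactSpace P]
  [TotallyDisconnectedSpace P] (G : PSCDatum P) (hG : IsTopologicallyFinitelyGenerated P)
  (hZ : Subgroup.center P = ⊥)
  {J : Type u} [Group J] [TopologicalSpace J] [IsTopologicalGroup J] [CompactSpace J]
  [TotallyDisconnectedSpace J] (θ : J →ₜ* outProfinite hG) (I : Subgroup J) [I.Normal]
  (σ : G.graph.N → ℕ) (hσ : ∀ e, IsSigmaInteger G.Sigma (σ e))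

include hZ

/-- **[AbsTopII] Prop 1.3 (i) AS TYPED (F-0297) at the DPSC-extension `Π_𝒢 ⋊^out_θ J` of construction data**,
from [CombGC] Rmk 1.1.3 for the PSC datum (cuspidal subgroups free pro-`Σ`-cyclic) ONLY.
[cite: MochizukiAbsTopII2013, Prop 1.3 (i) p.11] [cite: MochizukiCombGC2007, Rmk 1.1.3 p.7] -/
theorem prop_1_3_i_ofOuterAction (hcyc : ∀ c : G.graph.C, IsFreeProSigmaCyclic G.Sigma ↥(G.cuspGp c)) :
    Literature.AnabelianGeometry.AbsoluteAnabelian.AbsTopII.DPSCIndexData.Prop_1_3_i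
      (ofOuterAction G hG θ I σ hσ) :=
  prop_1_3_i_ofEmbedding G _ _ (inlProfinite hG θ).continuous (inlProfinite_injective hG θ hZ) _ _ _ _ _
    σ hσ hcyc

end OuterAction

end AbsTopII.DPSCIndexData

end Literature.AnabelianGeometry.AbsoluteAnabelian

end
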